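import Summits.ValiantsHypothesis.ValiantsHypothesis.Theorems.SOSBilinearHalf
import Mathlib
import HarnessLib

/-!
# Hurwitz points of the sum-of-squares road: `S(SOS_k) = k`, `B(SOS_k) = ⌈k/2⌉` at `k = 1, 2, 4, 8`,
# and the exact small-`k` table of `B_ℂ(SOS_k)`, `k ≤ 8`

Third file of CALL O-L6-9 (workshop `decomp-valiant`, lens 6, gen 33), after `SOSBilinearCalibration`
(floors `k ≤ S_F(SOS_k)`, `k ≤ 2·B_F(SOS_k)`, monotonicity) and `SOSBilinearHalf` (`B = ⌈S/2⌉`). Here the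
classical 1-, 2-, 4- (Euler 1748) and 8- (Degen 1818) square identities are typed as explicit bilinear
tables with entries `0, ±1` — each form `z_l = Σ_i s_l(i)·x_i y_{π_l(i)}` is a SIGNED PERMUTATION table
(`permTable`; for `k = 8`, `π_l(i) = l XOR i`) — giving over every commutative ring

* `S_F(SOS_k) ≤ k` for `k ∈ {1, 2, 4, 8}` (`sqComplexity_sosPoly_le_*`), hence with a square root `c` of
  `-1` (pairing, `SOSBilinearHalf.pair_rep`) `B_F(SOS_k) ≤ 1, 1, 2, 4`;

and over every field `K` with `2 ≠ 0` and `c² = -1` (e.g. `ℂ`, `c = Complex.I`), together with the floors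
and monotonicity, the EXACT VALUES

* `S_K(SOS_k) = 1, 2, 4, 8` at `k = 1, 2, 4, 8` (the floor `k ≤ S` is attained exactly at the Hurwitz
  points) and the table **`B_K(SOS_k) = 1, 1, 2, 2, [3,4], [3,4], 4, 4` for `k = 1, …, 8`**
  (`bilinearComplexity_sosPoly_table`, `bilinearComplexity_complex_table`): the floor `⌈k/2⌉` of
  `SOSBilinearCalibration.le_two_mul_bilinearComplexity` is ATTAINED at `k = 1, 2, 3, 4, 7, 8`.

Not typed here: Hurwitz's theorem that `{1, 2, 4, 8}` are the ONLY `k` with `S(k) = k` (so `S_ℂ(3) = 4`,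
and `B_ℂ(SOS_5), B_ℂ(SOS_6) ∈ {3, 4}` stay undecided by these means). HONEST FRAMING: classical
identities, kernel-new; small-`k` CALIBRATION points of the numeric road hypothesis
`HWY10.SOSBilinearSuperlinear` — no circuit lower bound, nothing here bears on `VP ≠ VNP`.

## References
* [HrubesWigdersonYehudayoff2010] P. Hrubeš, A. Wigderson, A. Yehudayoff, Non-commutative circuits and
  the sum-of-squares problem, STOC 2010 (§1.2: "nontrivial identities exhibiting `S_ℝ(k) = k` for
  `k ∈ {1, 2, 4, 8}`"; Rem 1.5); J. Amer. Math. Soc. 24 (2011), Remark 1.6.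
* A. R. Rajwade, Squares, LMS Lecture Note Series 171, CUP 1993, Ch. 1 (the 2-, 4-, 8-identities and
  Hurwitz's 1, 2, 4, 8 theorem over any field of characteristic `≠ 2`).
-/

noncomputable section

namespace Summit.ValiantsHypothesis.ValiantsHypothesis.Theorems.SOSHurwitzPoints

open MvPolynomial
open Literature.Computability.AlgebraicComplexity
open Summit.ValiantsHypothesis.ValiantsHypothesis.Theorems.SOSBilinearCalibration
open Summit.ValiantsHypothesis.ValiantsHypothesis.Theorems.SOSBilinearHalf

universe u

/-! ## §1 Signed permutation tables and the 1-, 2-, 4-, 8-square identities -/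
section Identities

variable (F : Type u) [CommRing F]

/-- The SIGNED PERMUTATION table of `(π, s)`: entry `s i` at `(i, π i)`, zero elsewhere; its bilinear form is
`Σ_i s(i)·x_i y_{π(i)}`. [folklore] [cite: HrubesWigdersonYehudayoff2010, §1.2] -/
def permTable {k : ℕ} (π : Fin k → Fin k) (s : Fin k → F) : Fin k → Fin k → F :=
  fun i j => if j = π i then s i else 0

/-- `z_{(π,s)} = Σ_i s(i)·x_i y_{π(i)}`. [folklore] [cite: HrubesWigdersonYehudayoff2010, §1.2] -/
theorem bilinForm_permTable {k : ℕ} (π : Fin k → Fin k) (s : Fin k → F) :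
    HWY10.bilinForm F (permTable F π s) = ∑ i, s i • (X (Sum.inl i) * X (Sum.inr (π i))) := by
  unfold HWY10.bilinForm permTable
  refine Finset.sum_congr rfl fun i _ => ?_
  simp only [ite_smul, zero_smul, Finset.sum_ite_eq', Finset.mem_univ, if_true]

/-- The 2-square identity `(x₀²+x₁²)(y₀²+y₁²) = (x₀y₀ − x₁y₁)² + (x₀y₁ + x₁y₀)²`: permutations.
[folklore] [cite: HrubesWigdersonYehudayoff2010, §1.2] -/
def perm₂ : Fin 2 → Fin 2 → Fin 2 := ![![0, 1], ![1, 0]]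

/-- The 2-square identity: signs. [folklore] [cite: HrubesWigdersonYehudayoff2010, §1.2] -/
def sign₂ : Fin 2 → Fin 2 → F := ![![1, -1], ![1, 1]]

/-- Euler's 4-square identity (quaternion multiplication table): permutations `π_l(i) = l XOR i`.
[folklore] [cite: HrubesWigdersonYehudayoff2010, §1.2] -/
def perm₄ : Fin 4 → Fin 4 → Fin 4 := ![![0, 1, 2, 3], ![1, 0, 3, 2], ![2, 3, 0, 1], ![3, 2, 1, 0]]

/-- Euler's 4-square identity: signs. [folklore] [cite: HrubesWigdersonYehudayoff2010, §1.2] -/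
def sign₄ : Fin 4 → Fin 4 → F :=
  ![![1, -1, -1, -1], ![1, 1, 1, -1], ![1, -1, 1, 1], ![1, 1, -1, 1]]

/-- Degen's 8-square identity (octonion multiplication table): permutations `π_l(i) = l XOR i`.
[folklore] [cite: HrubesWigdersonYehudayoff2010, §1.2] -/
def perm₈ : Fin 8 → Fin 8 → Fin 8 :=
  ![![0, 1, 2, 3, 4, 5, 6, 7], ![1, 0, 3, 2, 5, 4, 7, 6], ![2, 3, 0, 1, 6, 7, 4, 5], ![3, 2, 1, 0, 7, 6, 5, 4],
    ![4, 5, 6, 7, 0, 1, 2, 3], ![5, 4, 7, 6, 1, 0, 3, 2], ![6, 7, 4, 5, 2, 3, 0, 1], ![7, 6, 5, 4, 3, 2, 1, 0]]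

/-- Degen's 8-square identity: signs. [folklore] [cite: HrubesWigdersonYehudayoff2010, §1.2] -/
def sign₈ : Fin 8 → Fin 8 → F :=
  ![![1, -1, -1, -1, -1, -1, -1, -1], ![1, 1, 1, -1, 1, -1, -1, 1], ![1, -1, 1, 1, 1, 1, -1, -1],
    ![1, 1, -1, 1, 1, -1, 1, -1], ![1, -1, -1, -1, 1, 1, 1, 1], ![1, 1, -1, 1, -1, 1, -1, 1],
    ![1, 1, 1, -1, -1, 1, 1, -1], ![1, -1, 1, 1, -1, -1, 1, 1]]

/-- `SOS_1 = (x₀y₀)²`: one square. [folklore] [cite: HrubesWigdersonYehudayoff2010, §1.2] -/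
theorem sosPoly_one_eq : HWY10.sosPoly F 1 =
    ∑ l : Fin 1, HWY10.bilinForm F ((fun _ => permTable F (fun i => i) fun _ => (1 : F)) l) ^ 2 := by
  simp only [bilinForm_permTable, HWY10.sosPoly, Fin.sum_univ_one, one_smul]
  ring

/-- The 2-square identity as two squares of signed-permutation bilinear forms.
[folklore] [cite: HrubesWigdersonYehudayoff2010, §1.2] -/
theorem sosPoly_two_eq : HWY10.sosPoly F 2 =
    ∑ l : Fin 2, HWY10.bilinForm F (permTable F (perm₂ l) (sign₂ F l)) ^ 2 := by
  simp only [bilinForm_permTable, HWY10.sosPoly, Fin.sum_univ_two, perm₂, sign₂, Matrix.cons_val, one_smul,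
    neg_smul]
  ring

/-- Euler's 4-square identity as four squares of signed-permutation bilinear forms.
[folklore] [cite: HrubesWigdersonYehudayoff2010, §1.2] -/
theorem sosPoly_four_eq : HWY10.sosPoly F 4 =
    ∑ l : Fin 4, HWY10.bilinForm F (permTable F (perm₄ l) (sign₄ F l)) ^ 2 := by
  simp only [bilinForm_permTable, HWY10.sosPoly, Fin.sum_univ_four, perm₄, sign₄, Matrix.cons_val, one_smul,
    neg_smul]
  ring

/-- Degen's 8-square identity as eight squares of signed-permutation bilinear forms.
[folklore] [cite: HrubesWigdersonYehudayoff2010, §1.2] -/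
theorem sosPoly_eight_eq : HWY10.sosPoly F 8 =
    ∑ l : Fin 8, HWY10.bilinForm F (permTable F (perm₈ l) (sign₈ F l)) ^ 2 := by
  simp only [bilinForm_permTable, HWY10.sosPoly, Fin.sum_univ_eight, perm₈, sign₈, Matrix.cons_val, one_smul,
    neg_smul]
  ring

/-- `S_F(SOS_1) ≤ 1`. [folklore] [cite: HrubesWigdersonYehudayoff2010, §1.2] -/
theorem sqComplexity_sosPoly_one_le : sqComplexity F (HWY10.sosPoly F 1) ≤ 1 :=
  sqComplexity_le_of_rep _ (sosPoly_one_eq F)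

/-- `S_F(SOS_2) ≤ 2`. [folklore] [cite: HrubesWigdersonYehudayoff2010, §1.2] -/
theorem sqComplexity_sosPoly_two_le : sqComplexity F (HWY10.sosPoly F 2) ≤ 2 :=
  sqComplexity_le_of_rep _ (sosPoly_two_eq F)

/-- `S_F(SOS_4) ≤ 4` (Euler). [folklore] [cite: HrubesWigdersonYehudayoff2010, §1.2] -/
theorem sqComplexity_sosPoly_four_le : sqComplexity F (HWY10.sosPoly F 4) ≤ 4 :=
  sqComplexity_le_of_rep _ (sosPoly_four_eq F)

/-- `S_F(SOS_8) ≤ 8` (Degen). [folklore] [cite: HrubesWigdersonYehudayoff2010, §1.2] -/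
theorem sqComplexity_sosPoly_eight_le : sqComplexity F (HWY10.sosPoly F 8) ≤ 8 :=
  sqComplexity_le_of_rep _ (sosPoly_eight_eq F)

variable {F}

/-- Pairing the squares: `n` squares for `SOS_k` give `B_F(SOS_k) ≤ ⌈n/2⌉` when `F` has `c` with
`c² = -1`. [cite: HrubesWigdersonYehudayoff2010, Rem. 1.5] -/
theorem bilinearComplexity_le_of_sqRep (c : F) (hc : c * c = -1) {k n : ℕ}
    {z : Fin n → Fin k → Fin k → F} (h : HWY10.sosPoly F k = ∑ l, HWY10.bilinForm F (z l) ^ 2) :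
    HWY10.bilinearComplexity F (HWY10.sosPoly F k) ≤ (n + 1) / 2 := by
  obtain ⟨m, hm, a, b, hab⟩ := pair_rep c hc n _ z h
  exact (bilinearComplexity_le_of_rep a b hab).trans hm

/-- The Hurwitz upper points for `B`: `B_F(SOS_1) ≤ 1`, `B_F(SOS_2) ≤ 1`, `B_F(SOS_4) ≤ 2`,
`B_F(SOS_8) ≤ 4` over any commutative ring with a square root of `-1`.
[folklore] [cite: HrubesWigdersonYehudayoff2010, Rem. 1.5] -/
theorem bilinearComplexity_sosPoly_le_hurwitz (c : F) (hc : c * c = -1) :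
    HWY10.bilinearComplexity F (HWY10.sosPoly F 1) ≤ 1 ∧ HWY10.bilinearComplexity F (HWY10.sosPoly F 2) ≤ 1 ∧
      HWY10.bilinearComplexity F (HWY10.sosPoly F 4) ≤ 2 ∧
        HWY10.bilinearComplexity F (HWY10.sosPoly F 8) ≤ 4 :=
  ⟨(bilinearComplexity_le_of_sqRep c hc (sosPoly_one_eq F)).trans (by norm_num),
    (bilinearComplexity_le_of_sqRep c hc (sosPoly_two_eq F)).trans (by norm_num),
    (bilinearComplexity_le_of_sqRep c hc (sosPoly_four_eq F)).trans (by norm_num),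
    (bilinearComplexity_le_of_sqRep c hc (sosPoly_eight_eq F)).trans (by norm_num)⟩

end Identities

/-! ## §2 Exact values over a field with `2 ≠ 0` and `√-1` -/
section Exact

variable {K : Type u} [Field K]

/-- **`S_K(SOS_k) = k` at the Hurwitz points `k = 1, 2, 4, 8`**, and `S_K(SOS_3) ∈ {3, 4}`, over every
field with `2 ≠ 0` (floor `SOSBilinearCalibration.le_sqComplexity` + the identities + monotonicity).
[folklore] [cite: HrubesWigdersonYehudayoff2010, §1.2] -/
theorem sqComplexity_sosPoly_hurwitz (h2 : (2 : K) ≠ 0) :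
    sqComplexity K (HWY10.sosPoly K 1) = 1 ∧ sqComplexity K (HWY10.sosPoly K 2) = 2 ∧
      sqComplexity K (HWY10.sosPoly K 4) = 4 ∧ sqComplexity K (HWY10.sosPoly K 8) = 8 ∧
        3 ≤ sqComplexity K (HWY10.sosPoly K 3) ∧ sqComplexity K (HWY10.sosPoly K 3) ≤ 4 := by
  have f1 := le_sqComplexity h2 1
  have f2 := le_sqComplexity h2 2
  have f3 := le_sqComplexity h2 3
  have f4 := le_sqComplexity h2 4
  have f8 := le_sqComplexity h2 8
  have u1 := sqComplexity_sosPoly_one_le K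
  have u2 := sqComplexity_sosPoly_two_le K
  have u4 := sqComplexity_sosPoly_four_le K
  have u8 := sqComplexity_sosPoly_eight_le K
  have m34 := sqComplexity_sosPoly_mono K (show 3 ≤ 4 by norm_num)
  omega

/-- **THE SMALL-`k` TABLE FOR `B`** over every field with `2 ≠ 0` containing `c` with `c² = -1`:
`B_K(SOS_k) = 1, 1, 2, 2` for `k = 1, 2, 3, 4`; `3 ≤ B_K(SOS_5), B_K(SOS_6) ≤ 4`; `B_K(SOS_7) = B_K(SOS_8) = 4`
(floor `k ≤ 2B` + Hurwitz upper points + monotonicity). [folklore] [cite: HrubesWigdersonYehudayoff2010, Rem. 1.5] -/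
theorem bilinearComplexity_sosPoly_table (h2 : (2 : K) ≠ 0) (c : K) (hc : c * c = -1) :
    HWY10.bilinearComplexity K (HWY10.sosPoly K 1) = 1 ∧ HWY10.bilinearComplexity K (HWY10.sosPoly K 2) = 1 ∧
      HWY10.bilinearComplexity K (HWY10.sosPoly K 3) = 2 ∧ HWY10.bilinearComplexity K (HWY10.sosPoly K 4) = 2 ∧
      (3 ≤ HWY10.bilinearComplexity K (HWY10.sosPoly K 5) ∧ HWY10.bilinearComplexity K (HWY10.sosPoly K 5) ≤ 4) ∧
      (3 ≤ HWY10.bilinearComplexity K (HWY10.sosPoly K 6) ∧ HWY10.bilinearComplexity K (HWY10.sosPoly K 6) ≤ 4) ∧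
      HWY10.bilinearComplexity K (HWY10.sosPoly K 7) = 4 ∧ HWY10.bilinearComplexity K (HWY10.sosPoly K 8) = 4 := by
  obtain ⟨u1, u2, u4, u8⟩ := bilinearComplexity_sosPoly_le_hurwitz c hc (F := K)
  have f1 := le_two_mul_bilinearComplexity h2 1
  have f2 := le_two_mul_bilinearComplexity h2 2
  have f3 := le_two_mul_bilinearComplexity h2 3
  have f4 := le_two_mul_bilinearComplexity h2 4
  have f5 := le_two_mul_bilinearComplexity h2 5
  have f6 := le_two_mul_bilinearComplexity h2 6
  have f7 := le_two_mul_bilinearComplexity h2 7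
  have f8 := le_two_mul_bilinearComplexity h2 8
  have m34 := bilinearComplexity_sosPoly_mono K (show 3 ≤ 4 by norm_num)
  have m58 := bilinearComplexity_sosPoly_mono K (show 5 ≤ 8 by norm_num)
  have m68 := bilinearComplexity_sosPoly_mono K (show 6 ≤ 8 by norm_num)
  have m78 := bilinearComplexity_sosPoly_mono K (show 7 ≤ 8 by norm_num)
  omega

/-- **Over `ℂ`** (`2 ≠ 0`, `c = i`): `B_ℂ(SOS_k) = 1, 1, 2, 2` (`k ≤ 4`), `∈ [3, 4]` (`k = 5, 6`), `= 4`
(`k = 7, 8`) — the small-`k` calibration points of `HWY10.SOSBilinearSuperlinear ℂ`.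
[folklore] [cite: HrubesWigdersonYehudayoff2010, Rem. 1.5] -/
theorem bilinearComplexity_complex_table :
    HWY10.bilinearComplexity ℂ (HWY10.sosPoly ℂ 1) = 1 ∧ HWY10.bilinearComplexity ℂ (HWY10.sosPoly ℂ 2) = 1 ∧
      HWY10.bilinearComplexity ℂ (HWY10.sosPoly ℂ 3) = 2 ∧ HWY10.bilinearComplexity ℂ (HWY10.sosPoly ℂ 4) = 2 ∧
      (3 ≤ HWY10.bilinearComplexity ℂ (HWY10.sosPoly ℂ 5) ∧ HWY10.bilinearComplexity ℂ (HWY10.sosPoly ℂ 5) ≤ 4) ∧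
      (3 ≤ HWY10.bilinearComplexity ℂ (HWY10.sosPoly ℂ 6) ∧ HWY10.bilinearComplexity ℂ (HWY10.sosPoly ℂ 6) ≤ 4) ∧
      HWY10.bilinearComplexity ℂ (HWY10.sosPoly ℂ 7) = 4 ∧ HWY10.bilinearComplexity ℂ (HWY10.sosPoly ℂ 8) = 4 :=
  bilinearComplexity_sosPoly_table two_ne_zero Complex.I Complex.I_mul_I

/-- Over `ℂ`: `S_ℂ(SOS_k) = k` at `k = 1, 2, 4, 8` and `B_ℂ(SOS_k) = ⌈S_ℂ(SOS_k)/2⌉` (from `SOSBilinearHalf`).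
[folklore] [cite: HrubesWigdersonYehudayoff2010, Rem. 1.5] -/
theorem sqComplexity_complex_hurwitz :
    sqComplexity ℂ (HWY10.sosPoly ℂ 1) = 1 ∧ sqComplexity ℂ (HWY10.sosPoly ℂ 2) = 2 ∧
      sqComplexity ℂ (HWY10.sosPoly ℂ 4) = 4 ∧ sqComplexity ℂ (HWY10.sosPoly ℂ 8) = 8 ∧
        ∀ k : ℕ, HWY10.bilinearComplexity ℂ (HWY10.sosPoly ℂ k) = (sqComplexity ℂ (HWY10.sosPoly ℂ k) + 1) / 2 := by
  obtain ⟨e1, e2, e4, e8, -, -⟩ := sqComplexity_sosPoly_hurwitz (K := ℂ) two_ne_zero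
  exact ⟨e1, e2, e4, e8, fun k => bilinearComplexity_eq_half two_ne_zero Complex.I Complex.I_mul_I _⟩

end Exact

end Summit.ValiantsHypothesis.ValiantsHypothesis.Theorems.SOSHurwitzPoints

end
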